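import Mathlib
import Summits.Ventures.PercRepro2.MixChordOChords
import Summits.Ventures.PercRepro2.A3RootEdgeMain

/-!
# The root-edge closure of the `o`-class `D`-chord, modulo ONE inequality `(S)`
(blind cell PercRepro2, night-1 g22; proofs/NIGHT1-G22.md §5)

Let `e = {a₁, a₃}` be a root edge of `a₃` at weight `t = p e` and `f = {o, a₁}` the `o`-edge at weight
`q = p f`; write `p₀ = p[e ↦ 0]`, `p₁ = p[e ↦ 1]`, and `⁰` for the `o`-edge closed.  p5 g13's cleared
split identity `Q₀·Q₁·Gc(p) = (1 − t)²·Q·Q₁·Gc(p₀) + t(1 − t)·[D₀·Q·Q₀·g₁ + (1 − t)·df·dg]`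
(`RootEdge.key_identity`) applied at `p` and at `p⁰`, with `D(p) = (1 − t)·D₀` (`PD ⊆ {e closed}`) and
`Q = (1 − t)Q₀ + tQ₁`, turns the cleared deficit of the `D`-chord along `f`,
`Δ(p) = Gc(p)·D(p⁰) − (1 − q)·Gc(p⁰)·D(p)`, into the BERNSTEIN form (**`closure_identity`**)

  `M·Δ(p) = (1 − t)²·[ (1 − t)²·M·Δ₀ + t(1 − t)·(Q₀Q₁Q₁⁰²·Δ₀ + S) + t²·M·D₀D₀⁰·(g₁ − (1 − q)g₁⁰) ]`,

`M = Q₀Q₁Q₀⁰Q₁⁰`, where `Δ₀ = Gc(p₀)·D₀⁰ − (1 − q)·Gc(p₀⁰)·D₀` is the deficit WITHOUT the edge (the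
`D`-chord at `p₀`), `g₁ = J′(p₁)` so that `g₁ − (1 − q)g₁⁰ ≥ 0` is the `J′`-chord of MixChordOChords.lean at
`p₁` (**`g1_chord`**), and **`S`** (`SClosure`, the cleared form of NIGHT1-G22.md §5's
`(ρ − ρ⁰)Gc₀D₀⁰ + D₀D₀⁰[g₁/ρ − (1 − q)g₁⁰/ρ⁰] + [df·dg·D₀⁰/(Q₀Q₁) − (1 − q)df⁰dg⁰D₀/(Q₀⁰Q₁⁰)]`, `ρ = Q₁/Q₀`)
is the ONE inequality left: census-true (240 / 240) and tight.  Hence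

* **`dChord_of_update_zero_of_S`**: `0 ≤ S` and the `D`-chord at `p[e ↦ 0]` give the `D`-chord at `p`
  (nondegenerate masses `0 < M`) — the chord analogue of p5's `HCov_of_update_zero`: the `o`-class row is
  closed under adding an edge between `a₃` and the root of the `o`-edge, modulo `(S)`.

Own code; standard axioms.
-/

namespace Summit.Ventures.PercRepro2

open UnionCluster CovForm

namespace Mix

section Closure

variable {V : Type*} {E : Type*} [Fintype E] [DecidableEq E] [Fintype V] [DecidableEq V]
  {R : Type*} [Field R] [LinearOrder R] [IsStrictOrderedRing R]

variable (p : E → R) (ends : E → Sym2 V) (o a₁ a₂ a₃ b : V) (e : E)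

/-- p5's first piece at `p`: `g₁ = −2[Q₁(P₁(Q,bL,oH) − P₁(Q,bH,oH)) − (P₁(Q,bL) − P₁(Q,bH))·P₁(Q,oH)]`
(the masses at `p[e ↦ 1]`). -/
noncomputable def g1C : R :=
  -2 * (prob (Function.update p e 1) (avoidAll ends a₂ {a₁}) *
      (prob (Function.update p e 1) (avoidAll ends a₂ {a₁} ∩ (connEvent ends a₂ o ∩ connEvent ends a₁ b)) -
        prob (Function.update p e 1) (avoidAll ends a₂ {a₁} ∩ (connEvent ends a₂ o ∩ connEvent ends a₂ b))) -
    (prob (Function.update p e 1) (avoidAll ends a₂ {a₁} ∩ connEvent ends a₁ b) -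
        prob (Function.update p e 1) (avoidAll ends a₂ {a₁} ∩ connEvent ends a₂ b)) *
      prob (Function.update p e 1) (avoidAll ends a₂ {a₁} ∩ connEvent ends a₂ o))

/-- p5's second piece: `df = Q₀·(P₁(Q,bL) − P₁(Q,bH)) − Q₁·(P₀(Q,bL) − P₀(Q,bH))`. -/
noncomputable def dfC : R :=
  prob (Function.update p e 0) (avoidAll ends a₂ {a₁}) *
      (prob (Function.update p e 1) (avoidAll ends a₂ {a₁} ∩ connEvent ends a₁ b) -
        prob (Function.update p e 1) (avoidAll ends a₂ {a₁} ∩ connEvent ends a₂ b)) -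
    prob (Function.update p e 1) (avoidAll ends a₂ {a₁}) *
      (prob (Function.update p e 0) (avoidAll ends a₂ {a₁} ∩ connEvent ends a₁ b) -
        prob (Function.update p e 0) (avoidAll ends a₂ {a₁} ∩ connEvent ends a₂ b))

/-- p5's third piece: `dg = D_o⁰·Q₀·Q₁ − 2·P₁(Q,oH)·D₀·Q₀ − DEF⁰·Q₁`. -/
noncomputable def dgC : R :=
  Do (Function.update p e 0) ends o a₁ a₂ a₃ * prob (Function.update p e 0) (avoidAll ends a₂ {a₁}) *
      prob (Function.update p e 1) (avoidAll ends a₂ {a₁}) -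
    2 * prob (Function.update p e 1) (avoidAll ends a₂ {a₁} ∩ connEvent ends a₂ o) *
      prob (Function.update p e 0) (PDEvent ends a₁ a₂ a₃) *
      prob (Function.update p e 0) (avoidAll ends a₂ {a₁}) -
    DEF (Function.update p e 0) ends o a₁ a₂ a₃ * prob (Function.update p e 1) (avoidAll ends a₂ {a₁})

variable (f : E)

/-- **The remaining inequality `(S)` of the root-edge closure, cleared by `Q₀Q₁Q₀⁰Q₁⁰`**: with
`A = Q₀ = P_{p[e↦0]}(Q)`, `B = Q₁ = P_{p[e↦1]}(Q)`, `D = D₀ = P_{p[e↦0]}(PD)`, `G = Gc(p[e↦0])`, `g = g₁`, `u = df`,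
`w = dg`, and `⁰` the `o`-edge `f` closed,
`S = (B·A⁰ − B⁰·A)·B·B⁰·G·D⁰ + D·D⁰·A·A⁰·[g·A·B⁰ − (1 − q)·g⁰·A⁰·B] + [u·w·D⁰·A⁰·B⁰ − (1 − q)·u⁰w⁰·D·A·B]`. -/
noncomputable def SClosure : R :=
  (prob (Function.update p e 1) (avoidAll ends a₂ {a₁}) *
        prob (Function.update (Function.update p f 0) e 0) (avoidAll ends a₂ {a₁}) -
      prob (Function.update (Function.update p f 0) e 1) (avoidAll ends a₂ {a₁}) *
        prob (Function.update p e 0) (avoidAll ends a₂ {a₁})) *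
      prob (Function.update p e 1) (avoidAll ends a₂ {a₁}) *
      prob (Function.update (Function.update p f 0) e 1) (avoidAll ends a₂ {a₁}) *
      Gc (Function.update p e 0) ends o a₁ a₂ a₃ b *
      prob (Function.update (Function.update p f 0) e 0) (PDEvent ends a₁ a₂ a₃) +
    prob (Function.update p e 0) (PDEvent ends a₁ a₂ a₃) *
      prob (Function.update (Function.update p f 0) e 0) (PDEvent ends a₁ a₂ a₃) *
      prob (Function.update p e 0) (avoidAll ends a₂ {a₁}) *
      prob (Function.update (Function.update p f 0) e 0) (avoidAll ends a₂ {a₁}) *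
      (g1C p ends o a₁ a₂ b e * prob (Function.update p e 0) (avoidAll ends a₂ {a₁}) *
          prob (Function.update (Function.update p f 0) e 1) (avoidAll ends a₂ {a₁}) -
        (1 - p f) * g1C (Function.update p f 0) ends o a₁ a₂ b e *
          prob (Function.update (Function.update p f 0) e 0) (avoidAll ends a₂ {a₁}) *
          prob (Function.update p e 1) (avoidAll ends a₂ {a₁})) +
    (dfC p ends a₁ a₂ b e * dgC p ends o a₁ a₂ a₃ e *
        prob (Function.update (Function.update p f 0) e 0) (PDEvent ends a₁ a₂ a₃) *
        prob (Function.update (Function.update p f 0) e 0) (avoidAll ends a₂ {a₁}) *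
        prob (Function.update (Function.update p f 0) e 1) (avoidAll ends a₂ {a₁}) -
      (1 - p f) * dfC (Function.update p f 0) ends a₁ a₂ b e * dgC (Function.update p f 0) ends o a₁ a₂ a₃ e *
        prob (Function.update p e 0) (PDEvent ends a₁ a₂ a₃) *
        prob (Function.update p e 0) (avoidAll ends a₂ {a₁}) *
        prob (Function.update p e 1) (avoidAll ends a₂ {a₁}))

end Closure

section Theorem

variable {V : Type*} {E : Type*} [Fintype E] [DecidableEq E] [Fintype V] [DecidableEq V]
  {R : Type*} [Field R] [LinearOrder R] [IsStrictOrderedRing R]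

variable (p : E → R) (ends : E → Sym2 V) {o a₁ a₂ a₃ : V} (b : V) {e f : E}

omit [Fintype V] [DecidableEq V] [LinearOrder R] [IsStrictOrderedRing R] in
/-- p5's first piece is the `J′` functional at the pinned instance `p[e ↦ 1]`. -/
lemma g1C_eq (o a₁ a₂ : V) (e : E) :
    g1C p ends o a₁ a₂ b e =
      2 * PendantRoot.covC (Function.update p e 1) ends a₁ a₂ (connEvent ends a₂ o) (connEvent ends a₂ b) -
        2 * PendantRoot.covC (Function.update p e 1) ends a₁ a₂ (connEvent ends a₂ o) (connEvent ends a₁ b) := by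
  unfold g1C PendantRoot.covC
  ring

omit [Fintype V] [DecidableEq V] in
/-- **The `g₁`-chord** along the `o`-edge `f = {o, a₁}`: `(1 − q)·g₁⁰ ≤ g₁` — the `J′`-chord at `p[e ↦ 1]`. -/
lemma g1_chord (hp : IsProbVec p) (hf : ends f = s(o, a₁)) (hef : e ≠ f) :
    (1 - p f) * g1C (Function.update p f 0) ends o a₁ a₂ b e ≤ g1C p ends o a₁ a₂ b e := by
  have hp1 : IsProbVec (Function.update p e 1) := hp.update e zero_le_one le_rfl
  have h := j'Chord (Function.update p e 1) ends (a₂ := a₂) b hp1 hf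
  rw [Function.update_of_ne hef.symm, Function.update_comm hef] at h
  rw [g1C_eq, g1C_eq]
  exact h

omit [Fintype V] [DecidableEq V] [LinearOrder R] [IsStrictOrderedRing R] in
/-- `D(p) = (1 − t)·D₀` (`PD ⊆ {e closed}`). -/
lemma prob_PD_eq_update_zero (hends : ends e = s(a₁, a₃)) :
    prob p (PDEvent ends a₁ a₂ a₃) = (1 - p e) * prob (Function.update p e 0) (PDEvent ends a₁ a₂ a₃) := by
  rw [prob_eq_pin p (PDEvent ends a₁ a₂ a₃) e, RootEdge.prob_one_PD p hends a₂, mul_zero, zero_add]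

omit [Fintype V] [DecidableEq V] in
/-- p5's split identity with the three pieces folded (`g1C`, `dfC`, `dgC`). -/
lemma key_folded (hends : ends e = s(a₁, a₃)) :
    prob (Function.update p e 0) (avoidAll ends a₂ {a₁}) *
        prob (Function.update p e 1) (avoidAll ends a₂ {a₁}) * Gc p ends o a₁ a₂ a₃ b =
      (1 - p e) ^ 2 * prob p (avoidAll ends a₂ {a₁}) *
          prob (Function.update p e 1) (avoidAll ends a₂ {a₁}) *
          Gc (Function.update p e 0) ends o a₁ a₂ a₃ b +
        p e * (1 - p e) *
          (prob (Function.update p e 0) (PDEvent ends a₁ a₂ a₃) * prob p (avoidAll ends a₂ {a₁}) *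
              prob (Function.update p e 0) (avoidAll ends a₂ {a₁}) * g1C p ends o a₁ a₂ b e +
            (1 - p e) * (dfC p ends a₁ a₂ b e * dgC p ends o a₁ a₂ a₃ e)) := by
  have h := RootEdge.key_identity p ends o a₁ a₂ a₃ b e hends
  unfold g1C dfC dgC
  linear_combination h

omit [Fintype V] [DecidableEq V] in
set_option maxRecDepth 4000 in
/-- **The Bernstein identity of the root-edge closure** (see the module docstring): with `M = Q₀Q₁Q₀⁰Q₁⁰`,
`M·[Gc(p)·D(p⁰) − (1 − q)·Gc(p⁰)·D(p)] = (1 − t)²·[(1 − t)²·M·Δ₀ + t(1 − t)·(Q₀Q₁Q₁⁰²·Δ₀ + S) + t²·M·D₀D₀⁰·(g₁ − (1 − q)g₁⁰)]`. -/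
theorem closure_identity (hends : ends e = s(a₁, a₃)) (hef : e ≠ f) :
    prob (Function.update p e 0) (avoidAll ends a₂ {a₁}) * prob (Function.update p e 1) (avoidAll ends a₂ {a₁}) *
        prob (Function.update (Function.update p f 0) e 0) (avoidAll ends a₂ {a₁}) *
        prob (Function.update (Function.update p f 0) e 1) (avoidAll ends a₂ {a₁}) *
        (Gc p ends o a₁ a₂ a₃ b * prob (Function.update p f 0) (PDEvent ends a₁ a₂ a₃) -
          (1 - p f) * Gc (Function.update p f 0) ends o a₁ a₂ a₃ b * prob p (PDEvent ends a₁ a₂ a₃)) =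
      (1 - p e) ^ 2 *
        ((1 - p e) ^ 2 *
            (prob (Function.update p e 0) (avoidAll ends a₂ {a₁}) * prob (Function.update p e 1) (avoidAll ends a₂ {a₁}) *
              prob (Function.update (Function.update p f 0) e 0) (avoidAll ends a₂ {a₁}) *
              prob (Function.update (Function.update p f 0) e 1) (avoidAll ends a₂ {a₁})) *
            (Gc (Function.update p e 0) ends o a₁ a₂ a₃ b *
                prob (Function.update (Function.update p f 0) e 0) (PDEvent ends a₁ a₂ a₃) -
              (1 - p f) * Gc (Function.update (Function.update p f 0) e 0) ends o a₁ a₂ a₃ b *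
                prob (Function.update p e 0) (PDEvent ends a₁ a₂ a₃)) +
          p e * (1 - p e) *
            (prob (Function.update p e 0) (avoidAll ends a₂ {a₁}) * prob (Function.update p e 1) (avoidAll ends a₂ {a₁}) *
                prob (Function.update (Function.update p f 0) e 1) (avoidAll ends a₂ {a₁}) ^ 2 *
                (Gc (Function.update p e 0) ends o a₁ a₂ a₃ b *
                    prob (Function.update (Function.update p f 0) e 0) (PDEvent ends a₁ a₂ a₃) -
                  (1 - p f) * Gc (Function.update (Function.update p f 0) e 0) ends o a₁ a₂ a₃ b *
                    prob (Function.update p e 0) (PDEvent ends a₁ a₂ a₃)) +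
              SClosure p ends o a₁ a₂ a₃ b e f) +
          p e ^ 2 *
            (prob (Function.update p e 0) (avoidAll ends a₂ {a₁}) * prob (Function.update p e 1) (avoidAll ends a₂ {a₁}) *
              prob (Function.update (Function.update p f 0) e 0) (avoidAll ends a₂ {a₁}) *
              prob (Function.update (Function.update p f 0) e 1) (avoidAll ends a₂ {a₁})) *
            (prob (Function.update p e 0) (PDEvent ends a₁ a₂ a₃) *
              prob (Function.update (Function.update p f 0) e 0) (PDEvent ends a₁ a₂ a₃)) *
            (g1C p ends o a₁ a₂ b e - (1 - p f) * g1C (Function.update p f 0) ends o a₁ a₂ b e)) := by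
  have k₁ := key_folded p ends b (o := o) (a₂ := a₂) hends
  have k₂ := key_folded (Function.update p f 0) ends b (o := o) (a₂ := a₂) hends
  have hQ₁ := prob_eq_pin p (avoidAll ends a₂ {a₁}) e
  have hQ₂ := prob_eq_pin (Function.update p f 0) (avoidAll ends a₂ {a₁}) e
  have hD₁ := prob_PD_eq_update_zero p ends (a₂ := a₂) hends
  have hD₂ := prob_PD_eq_update_zero (Function.update p f 0) ends (a₂ := a₂) hends
  rw [Function.update_of_ne hef] at k₂ hQ₂ hD₂
  rw [hQ₁] at k₁
  rw [hQ₂] at k₂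
  rw [hD₁, hD₂]
  unfold SClosure
  linear_combination
    (prob (Function.update (Function.update p f 0) e 0) (avoidAll ends a₂ {a₁}) *
        prob (Function.update (Function.update p f 0) e 1) (avoidAll ends a₂ {a₁}) *
        ((1 - p e) * prob (Function.update (Function.update p f 0) e 0) (PDEvent ends a₁ a₂ a₃))) * k₁ -
    ((1 - p f) * (1 - p e) * prob (Function.update p e 0) (PDEvent ends a₁ a₂ a₃) *
        prob (Function.update p e 0) (avoidAll ends a₂ {a₁}) *
        prob (Function.update p e 1) (avoidAll ends a₂ {a₁})) * k₂

omit [Fintype V] [DecidableEq V] in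
/-- **THE ROOT-EDGE CLOSURE OF THE `o`-CLASS `D`-CHORD, MODULO `(S)`**: for `e = {a₁, a₃}` and
`f = {o, a₁}` with nondegenerate masses `0 < Q₀Q₁Q₀⁰Q₁⁰`, `0 ≤ S` and the `D`-chord at `p[e ↦ 0]` give
the `D`-chord at `p` — the chord analogue of p5 g13's `HCov_of_update_zero`. -/
theorem dChord_of_update_zero_of_S (hp : IsProbVec p) (hends : ends e = s(a₁, a₃))
    (hf : ends f = s(o, a₁)) (hef : e ≠ f)
    (hM : 0 < prob (Function.update p e 0) (avoidAll ends a₂ {a₁}) *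
      prob (Function.update p e 1) (avoidAll ends a₂ {a₁}) *
      prob (Function.update (Function.update p f 0) e 0) (avoidAll ends a₂ {a₁}) *
      prob (Function.update (Function.update p f 0) e 1) (avoidAll ends a₂ {a₁}))
    (hS : 0 ≤ SClosure p ends o a₁ a₂ a₃ b e f)
    (h0 : NMixChord (normD ends a₁ a₂ a₃) (Function.update p e 0) ends o a₁ a₂ a₃ b f) :
    NMixChord (normD ends a₁ a₂ a₃) p ends o a₁ a₂ a₃ b f := by
  have hp0 : IsProbVec (Function.update p e 0) := hp.update e le_rfl zero_le_one
  have hpf : IsProbVec (Function.update p f 0) := hp.update f le_rfl zero_le_one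
  have hp0f : IsProbVec (Function.update (Function.update p f 0) e 0) := hpf.update e le_rfl zero_le_one
  have hG1 : Gc (Function.update p f 1) ends o a₁ a₂ a₃ b = 0 :=
    Gc_eq_zero_of_sure_conn_o _ ends o a₃ b (conn_a1_o_of_update_one p ends hf)
  have hG1' : Gc (Function.update (Function.update p e 0) f 1) ends o a₁ a₂ a₃ b = 0 :=
    Gc_eq_zero_of_sure_conn_o _ ends o a₃ b (conn_a1_o_of_update_one (Function.update p e 0) ends hf)
  unfold NMixChord normD at h0 ⊢
  rw [hG1', mul_zero, sub_zero, Function.update_of_ne hef.symm, Function.update_comm hef] at h0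
  rw [hG1, mul_zero, sub_zero]
  have hΔ₀ : 0 ≤ Gc (Function.update p e 0) ends o a₁ a₂ a₃ b *
      prob (Function.update (Function.update p f 0) e 0) (PDEvent ends a₁ a₂ a₃) -
      (1 - p f) * Gc (Function.update (Function.update p f 0) e 0) ends o a₁ a₂ a₃ b *
        prob (Function.update p e 0) (PDEvent ends a₁ a₂ a₃) := by linarith
  have hg := g1_chord p ends (a₂ := a₂) b hp hf hef
  have ht0 := hp.nonneg e
  have ht1 := hp.le_one e
  have h1t : 0 ≤ 1 - p e := sub_nonneg.2 ht1
  have hD0 := prob_nonneg hp0 (PDEvent ends a₁ a₂ a₃)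
  have hD0f := prob_nonneg hp0f (PDEvent ends a₁ a₂ a₃)
  have hQ0 := prob_nonneg hp0 (avoidAll ends a₂ {a₁})
  have hQ1 := prob_nonneg (hp.update e zero_le_one le_rfl) (avoidAll ends a₂ {a₁})
  have hQ1f := prob_nonneg (hpf.update e zero_le_one le_rfl) (avoidAll ends a₂ {a₁})
  have hid := closure_identity p ends b (o := o) (a₂ := a₂) hends hef
  have hbr : 0 ≤ (1 - p e) ^ 2 *
      ((1 - p e) ^ 2 *
          (prob (Function.update p e 0) (avoidAll ends a₂ {a₁}) * prob (Function.update p e 1) (avoidAll ends a₂ {a₁}) *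
            prob (Function.update (Function.update p f 0) e 0) (avoidAll ends a₂ {a₁}) *
            prob (Function.update (Function.update p f 0) e 1) (avoidAll ends a₂ {a₁})) *
          (Gc (Function.update p e 0) ends o a₁ a₂ a₃ b *
              prob (Function.update (Function.update p f 0) e 0) (PDEvent ends a₁ a₂ a₃) -
            (1 - p f) * Gc (Function.update (Function.update p f 0) e 0) ends o a₁ a₂ a₃ b *
              prob (Function.update p e 0) (PDEvent ends a₁ a₂ a₃)) +
        p e * (1 - p e) *
          (prob (Function.update p e 0) (avoidAll ends a₂ {a₁}) * prob (Function.update p e 1) (avoidAll ends a₂ {a₁}) *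
              prob (Function.update (Function.update p f 0) e 1) (avoidAll ends a₂ {a₁}) ^ 2 *
              (Gc (Function.update p e 0) ends o a₁ a₂ a₃ b *
                  prob (Function.update (Function.update p f 0) e 0) (PDEvent ends a₁ a₂ a₃) -
                (1 - p f) * Gc (Function.update (Function.update p f 0) e 0) ends o a₁ a₂ a₃ b *
                  prob (Function.update p e 0) (PDEvent ends a₁ a₂ a₃)) +
            SClosure p ends o a₁ a₂ a₃ b e f) +
        p e ^ 2 *
          (prob (Function.update p e 0) (avoidAll ends a₂ {a₁}) * prob (Function.update p e 1) (avoidAll ends a₂ {a₁}) *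
            prob (Function.update (Function.update p f 0) e 0) (avoidAll ends a₂ {a₁}) *
            prob (Function.update (Function.update p f 0) e 1) (avoidAll ends a₂ {a₁})) *
          (prob (Function.update p e 0) (PDEvent ends a₁ a₂ a₃) *
            prob (Function.update (Function.update p f 0) e 0) (PDEvent ends a₁ a₂ a₃)) *
          (g1C p ends o a₁ a₂ b e - (1 - p f) * g1C (Function.update p f 0) ends o a₁ a₂ b e)) := by
    have hM' := hM.le
    refine mul_nonneg (sq_nonneg _) (add_nonneg (add_nonneg ?_ ?_) ?_)
    · exact mul_nonneg (mul_nonneg (sq_nonneg _) hM') hΔ₀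
    · refine mul_nonneg (mul_nonneg ht0 h1t) (add_nonneg ?_ hS)
      exact mul_nonneg (mul_nonneg (mul_nonneg hQ0 hQ1) (sq_nonneg _)) hΔ₀
    · exact mul_nonneg (mul_nonneg (mul_nonneg (sq_nonneg _) hM') (mul_nonneg hD0 hD0f))
        (sub_nonneg.2 hg)
  rw [← hid] at hbr
  have hX := (mul_nonneg_iff_of_pos_left hM).1 hbr
  linarith

end Theorem

end Mix

end Summit.Ventures.PercRepro2
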